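import Literature.Probability.Percolation.ArmSeparationIntSurgery
import Literature.Probability.Percolation.ArmSeparationInnerBoundAt
import Literature.Probability.Percolation.ArmSeparationExtFourArmQ
import Literature.Probability.Percolation.ArmSeparationOutFramesFour
import Literature.Probability.Percolation.ArmSeparationInMoveFour
import Literature.Probability.Percolation.AnnulusFourArmOrder
import HarnessLib

/-!
# The internal separation step for four alternating arms: fenced inner tips, in cyclic order

Topic: Probability / Percolation; family `crit-perc`, at a general density `p`
(`P_p = triSitePercolation p`). A brick of the discharge of `Nolin2008_cor41` through the
near-critical arm-separation theorem for four arms of alternating colours (Nolin 2008, Thm. 11,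
`j = 4`, `σ = BWBW` [arXiv 0711.4948: Thm. 10], internal extremities, "uniformly in `p`,
`P̂` between `P_p` and `P_{1-p}`, `N ≤ L(p)`"). With `extFourArmQ m N` the four arms landed on
the sides `0, 2, 3, 5` of `∂Λ_N` (`ArmSeparationExtFourArmQ.lean`):

* `IntTinyExt4 m N k₀ K R₀` — **the output of the surgery**: the outer landing data of the four
  arms and, in four frames `i a < 6`, fenced inner tips (`IntFencedArm`, as in `IntTinyExt` for
  two arms) whose far ends are the outer attaching sites, TOGETHER WITH THE ORDER CERTIFICATE:
  the actual tips `ζ_a = frameIso (i a) (F_a.z) ∈ ∂Λ_m` satisfy `ζ₂ < ζ₃ < ζ₀` anticlockwise from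
  `ζ₁` (`hexShift`), i.e. the inner tips are met in the cyclic order of the outer landing sides;
* `extFourArmQ_inter_inGoodF_subset4` — **surgery**: `extFourArmQ m N ∩ InGoodF ⊆ IntTinyExt4`
  (fencing of each arm by `exists_intFencedArm_b_eq` in the frame where it leaves the right side,
  order certificate by `fourArm_chain` applied to the four tip paths cut at `∂Λ_{N+1}`, whose sites
  on `∂Λ_{N+1}` lie in the landing balls, inside the perimeter blocks of the sides `0, 2, 3, 5`);
* `real_not_inGoodF_le_at` — the framed good event fails with small probability at density `p`
  (twelve framed / colour-exchanged configurations, of laws `P_p` and `P_{1-p}`);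
* `real_extFourArmQ_le_step4_at` — **the step inequality at density `p`**:
  `P_p(extFourArmQ m N) ≤ P_p(IntTinyExt4 m N k₀ K R₀) + P_p(¬ InGoodF m …) · P_p(extFourArmQ (2m+1) N)`.

## References

* P. Nolin, *Near-critical percolation in two dimensions*, Electron. J. Probab. 13 (2008), §4.4,
  proof of Thm. 11, internal extremities [arXiv 0711.4948: Thm. 10, p. 12–13]. [Nolin2008]
* H. Kesten, *Scaling relations for 2D-percolation*, Comm. Math. Phys. 109 (1987), Lemma 2. [Kesten1987]
-/

noncomputable section

open MeasureTheory Set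

namespace Literature.Probability.Percolation

open LatticeModels HalfAnnulus

/-! ### The perimeter coordinate of framed points of the right side -/

/-- **The perimeter coordinate of a framed point of the open right side**: for `-K < y < 0`,
`hexPos K (frameIso i (K, y))` is `y + K`, `2K + y`, `2K - y`, `4K + y`, `5K + y`, `5K - y` for
`i = 0, …, 5`. [folklore] -/
theorem hexPos_frameIso_side0 {K : ℕ} {y : ℤ} (hy : -(K : ℤ) < y) (hy0 : y < 0) :
    hexPos K (frameIso 0 ![(K : ℤ), y]) = y + K ∧ hexPos K (frameIso 1 ![(K : ℤ), y]) = 2 * K + y ∧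
    hexPos K (frameIso 2 ![(K : ℤ), y]) = 2 * K - y ∧ hexPos K (frameIso 3 ![(K : ℤ), y]) = 4 * K + y ∧
    hexPos K (frameIso 4 ![(K : ℤ), y]) = 5 * K + y ∧ hexPos K (frameIso 5 ![(K : ℤ), y]) = 5 * K - y := by
  obtain ⟨e00, e01, e10, e11, e20, e21, e30, e31, e40, e41, e50, e51⟩ := frameIso_apply_formula (![(K : ℤ), y] : Site 2)
  simp only [Matrix.cons_val_zero, Matrix.cons_val_one] at e00 e01 e10 e11 e20 e21 e30 e31 e40 e41 e50 e51
  generalize frameIso 0 ![(K : ℤ), y] = w0 at e00 e01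
  generalize frameIso 1 ![(K : ℤ), y] = w1 at e10 e11
  generalize frameIso 2 ![(K : ℤ), y] = w2 at e20 e21
  generalize frameIso 3 ![(K : ℤ), y] = w3 at e30 e31
  generalize frameIso 4 ![(K : ℤ), y] = w4 at e40 e41
  generalize frameIso 5 ![(K : ℤ), y] = w5 at e50 e51
  rw [hexPos_of_coord K w0 _ _ e00 e01, hexPos_of_coord K w1 _ _ e10 e11, hexPos_of_coord K w2 _ _ e20 e21,
    hexPos_of_coord K w3 _ _ e30 e31, hexPos_of_coord K w4 _ _ e40 e41, hexPos_of_coord K w5 _ _ e50 e51]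
  refine ⟨?_, ?_, ?_, ?_, ?_, ?_⟩
  · rw [if_pos ⟨by omega, hy0⟩]
  · rw [if_neg (by omega), if_pos ⟨by omega, by omega⟩]; omega
  · rw [if_neg (by omega), if_neg (by omega), if_pos ⟨by omega, by omega⟩]
  · rw [if_neg (by omega), if_neg (by omega), if_neg (by omega), if_pos ⟨by omega, by omega⟩]; omega
  · rw [if_neg (by omega), if_neg (by omega), if_neg (by omega), if_neg (by omega), if_pos ⟨by omega, by omega⟩]; omega
  · rw [if_neg (by omega), if_neg (by omega), if_neg (by omega), if_neg (by omega), if_neg (by omega)]; omega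

/-- **Sites of `∂Λ_{N+1}` in a landing ball are on the open right side**: for `z ∈ sepLanding N`
and `v` of norm `N + 1` with `|v - z| < N/8`, `v = (N+1, y)` with `-(N+1) < y < 0`. [folklore] -/
theorem eq_side0_of_mem_landing_ball {N : ℕ} {z v : Site 2} (hz : z ∈ sepLanding N) (hv : v ∈ triOpenBall z (N / 8))
    (hvn : triNorm v = (N + 1 : ℕ)) : v = ![((N + 1 : ℕ) : ℤ), v 1] ∧ -((N + 1 : ℕ) : ℤ) < v 1 ∧ v 1 < 0 := by
  rw [mem_sepLanding] at hz
  rw [mem_triOpenBall, triNorm_lt_iff_lin] at hv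
  simp only [Pi.sub_apply] at hv
  have h8 : (((N / 8 : ℕ) : ℤ)) ≤ ((N / 4 : ℕ) : ℤ) := by exact_mod_cast Nat.div_le_div_left (by norm_num) (by norm_num)
  have h4 : 4 * (((N / 4 : ℕ) : ℤ)) ≤ N := by exact_mod_cast Nat.mul_div_le N 4
  have hmax := triNorm_eq_max v
  have hle := triNorm_le_iff_lin.1 hvn.le
  push_cast at hvn hle ⊢
  refine ⟨site_eq_vec2 ?_ rfl, by omega, by omega⟩
  rcases le_triNorm_iff_lin.1 hvn.ge with h | h | h | h | h | h <;> omega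

/-- **The perimeter block of a framed landing ball**: a site of norm `N + 1` of
`frameIso i '' (annulus ∪ landing ball)` lies in the perimeter block `[iK, (i+1)K)` of `∂Λ_K`,
`K = N + 1`, for the frames `i = 0, 2, 3, 5`. [folklore] -/
theorem hexPos_block_of_mem_frame_region {m N : ℕ} {z : Site 2} (hz : z ∈ sepLanding N) {i : ℕ}
    (hi : i = 0 ∨ i = 2 ∨ i = 3 ∨ i = 5) {v : Site 2}
    (hv : v ∈ frameIso i '' (triAnnulusSet m N ∪ triOpenBall z (N / 8))) (hvn : triNorm v = (N + 1 : ℕ)) :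
    (i : ℤ) * (N + 1 : ℕ) ≤ hexPos (N + 1) v ∧ hexPos (N + 1) v < (i + 1) * (N + 1 : ℕ) := by
  obtain ⟨v₀, hv₀, rfl⟩ := hv
  have hi6 : i < 6 := by omega
  rw [show ((frameIso i : triGraph ≃g triGraph) v₀) = frameIso i v₀ from rfl, triNorm_frameIso i hi6] at hvn
  rcases hv₀ with hv₀ | hv₀
  · exfalso; have := (mem_triAnnulusSet.1 hv₀).2; push_cast at hvn; omega
  obtain ⟨hve, hy, hy0⟩ := eq_side0_of_mem_landing_ball hz hv₀ hvn
  obtain ⟨f0, -, f2, f3, -, f5⟩ := hexPos_frameIso_side0 hy hy0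
  rw [show ((frameIso i : triGraph ≃g triGraph) v₀) = frameIso i v₀ from rfl, hve]
  rcases hi with rfl | rfl | rfl | rfl
  · rw [f0]; push_cast; omega
  · rw [f2]; push_cast; omega
  · rw [f3]; push_cast; omega
  · rw [f5]; push_cast; omega

/-! ### The output event of the surgery -/

/-- **Four alternating arms landed on `∂Λ_N`, fenced at their inner ends, in cyclic order**
(Nolin's `Ã^{η,·/η'₀,I'}_{4,BWBW}` at the microscopic inner separation, before the inward
extension, in cluster form): landing sites `z_a ∈ sepLanding N` and attaching sites `u_a` of the
four framed configurations `ω`, `frameConfig 2 ωᶜ`, `frameConfig 3 ω`, `frameConfig 5 ωᶜ`, the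
outer free spaces crossed through `u_a`; frames `i a < 6` and fenced arms — open ones `F₀, F₂` of
`frameConfig (i 0) ω`, `frameConfig (i 2) ω`, closed ones `F₁, F₃` (open arms of the complements)
— in the regions `(frameIso (i a))⁻¹ (frameIso s_a (annulus ∪ landing ball))`, `s = (0, 2, 3, 5)`,
with far ends `(frameIso (i a))⁻¹ (frameIso s_a u_a)`; and the order certificate: anticlockwise
from the actual tip `ζ₁`, `ζ₂ < ζ₃ < ζ₀` (`ζ_a = frameIso (i a) F_a.z ∈ ∂Λ_m`). [cite: Nolin2008, §4.4 (arXiv 0711.4948: proof of Thm. 10, p. 13, j = 4)] -/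
def IntTinyExt4 (m N k₀ K R₀ : ℕ) : Set (SiteConfig (Site 2)) :=
  {ω | ∃ z u : Fin 4 → Site 2, (∀ a, z a ∈ sepLanding N) ∧
    OpenVCrossThrough (sepOuterFence N (z 0)) (z 0 1 - (N / 64 : ℕ)) (z 0 1 + (N / 64 : ℕ)) ω (u 0) ∧
    OpenVCrossThrough (sepOuterFence N (z 1)) (z 1 1 - (N / 64 : ℕ)) (z 1 1 + (N / 64 : ℕ)) (frameConfig 2 ωᶜ) (u 1) ∧
    OpenVCrossThrough (sepOuterFence N (z 2)) (z 2 1 - (N / 64 : ℕ)) (z 2 1 + (N / 64 : ℕ)) (frameConfig 3 ω) (u 2) ∧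
    OpenVCrossThrough (sepOuterFence N (z 3)) (z 3 1 - (N / 64 : ℕ)) (z 3 1 + (N / 64 : ℕ)) (frameConfig 5 ωᶜ) (u 3) ∧
    ∃ i : Fin 4 → ℕ, (∀ a, i a < 6) ∧
    ∃ F₀ : IntFencedArm m ((frameIso (i 0)).symm '' armRegion m N (z 0)) k₀ K R₀ (frameConfig (i 0) ω),
    ∃ F₁ : IntFencedArm m ((frameIso (i 1)).symm '' (frameIso 2 '' armRegion m N (z 1))) k₀ K R₀ (frameConfig (i 1) ω)ᶜ,
    ∃ F₂ : IntFencedArm m ((frameIso (i 2)).symm '' (frameIso 3 '' armRegion m N (z 2))) k₀ K R₀ (frameConfig (i 2) ω),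
    ∃ F₃ : IntFencedArm m ((frameIso (i 3)).symm '' (frameIso 5 '' armRegion m N (z 3))) k₀ K R₀ (frameConfig (i 3) ω)ᶜ,
      F₀.b = (frameIso (i 0)).symm (u 0) ∧ F₁.b = (frameIso (i 1)).symm (frameIso 2 (u 1)) ∧
      F₂.b = (frameIso (i 2)).symm (frameIso 3 (u 2)) ∧ F₃.b = (frameIso (i 3)).symm (frameIso 5 (u 3)) ∧
      hexShift m (frameIso (i 1) F₁.z) (frameIso (i 2) F₂.z) < hexShift m (frameIso (i 1) F₁.z) (frameIso (i 3) F₃.z) ∧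
      hexShift m (frameIso (i 1) F₁.z) (frameIso (i 3) F₃.z) < hexShift m (frameIso (i 1) F₁.z) (frameIso (i 0) F₀.z)}

/-! ### Surgery -/

/-- The tip of an `IsIntJ` site has norm `m`. [folklore] -/
theorem triNorm_of_isIntJ {m : ℕ} {z : Site 2} (hz : IsIntJ m z) : triNorm z = m := by
  obtain ⟨h0, h1, h2⟩ := hz
  exact le_antisymm (triNorm_le_iff_lin.2 (by omega)) (le_triNorm_iff_lin.2 (Or.inl h0.ge))

/-- `frameIso i ((frameIso i)⁻¹ A) = A`. [folklore] -/
theorem image_frameIso_symm_image (i : ℕ) (A : Set (Site 2)) :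
    (frameIso i : triGraph ≃g triGraph) '' (((frameIso i).symm : triGraph ≃g triGraph) '' A) = A := by
  rw [Set.image_image]
  conv_rhs => rw [← Set.image_id A]
  refine Set.image_congr fun v _ => ?_
  exact (frameIso i).apply_symm_apply v

/-- **An open arm is fenced in the frame where it leaves the right side.** [cite: Nolin2008, §4.4 (arXiv 0711.4948: proof of Thm. 10, internal extremities)] -/
theorem exists_intFencedArm_open {m T k₀ K R₀ Kg : ℕ} (hm : 5 ≤ m) (hR₀ : 2 ≤ R₀)
    (hRg : ∀ i < Kg, 4 * trapScale R₀ i < m) {ω : SiteConfig (Site 2)} (hgood : InGoodF m T k₀ K R₀ Kg ω)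
    {A : Set (Site 2)} (hA : ∀ v ∈ A, (m : ℤ) ≤ triNorm v) (hA' : triAnnSet m (2 * m) ⊆ A)
    {y b : Site 2} (hy : triNorm y = m) (hb : 2 * (m : ℤ) < triNorm b) (hp : PathIn triGraph (A ∩ {v | v ∈ ω ↔ true}) y b) :
    ∃ i < 6, ∃ F : IntFencedArm m ((frameIso i).symm '' A) k₀ K R₀ (frameConfig i ω), F.b = (frameIso i).symm b := by
  obtain ⟨i, hi, y', hy0, hyn, hbn, P⟩ := exists_rightSide_pathIn_frameConfig hy hp
  have P' : PathIn triGraph (((frameIso i).symm '' A) ∩ frameConfig i ω) y' ((frameIso i).symm b) :=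
    P.mono fun v hv => ⟨hv.1, by simpa using hv.2⟩
  obtain ⟨⟨hf, hd, hu⟩, -⟩ := hgood i hi
  exact ⟨i, hi, exists_intFencedArm_b_eq hm (norm_le_of_mem_image_frame_symm hi hA) (haSet_subset_image_frame_symm hi hA') hR₀ hRg
    hf hd hu hy0 hyn (by rw [hbn]; exact hb) P'⟩

/-- **A closed arm is fenced in the frame where it leaves the right side.** [cite: Nolin2008, §4.4 (arXiv 0711.4948: proof of Thm. 10, internal extremities)] -/
theorem exists_intFencedArm_closed {m T k₀ K R₀ Kg : ℕ} (hm : 5 ≤ m) (hR₀ : 2 ≤ R₀)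
    (hRg : ∀ i < Kg, 4 * trapScale R₀ i < m) {ω : SiteConfig (Site 2)} (hgood : InGoodF m T k₀ K R₀ Kg ω)
    {A : Set (Site 2)} (hA : ∀ v ∈ A, (m : ℤ) ≤ triNorm v) (hA' : triAnnSet m (2 * m) ⊆ A)
    {y b : Site 2} (hy : triNorm y = m) (hb : 2 * (m : ℤ) < triNorm b) (hp : PathIn triGraph (A ∩ {v | v ∈ ω ↔ false}) y b) :
    ∃ i < 6, ∃ F : IntFencedArm m ((frameIso i).symm '' A) k₀ K R₀ (frameConfig i ω)ᶜ, F.b = (frameIso i).symm b := by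
  obtain ⟨i, hi, y', hy0, hyn, hbn, P⟩ := exists_rightSide_pathIn_frameConfig hy hp
  have P' : PathIn triGraph (((frameIso i).symm '' A) ∩ (frameConfig i ω)ᶜ) y' ((frameIso i).symm b) :=
    P.mono fun v hv => ⟨hv.1, by simpa using hv.2⟩
  obtain ⟨-, ⟨hf, hd, hu⟩⟩ := hgood i hi
  exact ⟨i, hi, exists_intFencedArm_b_eq hm (norm_le_of_mem_image_frame_symm hi hA) (haSet_subset_image_frame_symm hi hA') hR₀ hRg
    hf hd hu hy0 hyn (by rw [hbn]; exact hb) P'⟩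

/-- **The tip path of a fenced arm, back in the original frame, cut at `∂Λ_{N+1}`**: from the
actual tip `frameIso i F.z ∈ ∂Λ_m` a colour-`c` path of `ω` inside `{m ≤ |v| ≤ N+1} ∩ A` to a site
of norm `N + 1` (the far end `b`, of norm `≥ N + 1`, is `frameIso i F.b`). [folklore] -/
theorem IntFencedArm.exists_tip_path_cut {m N k₀ K R₀ i : ℕ} (hi : i < 6) {A : Set (Site 2)} {ω χ : SiteConfig (Site 2)} {c : Bool}
    (hAn : ∀ v ∈ A, (m : ℤ) ≤ triNorm v ∧ triNorm v ≤ ((N + N / 8 : ℕ) : ℤ))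
    (F : IntFencedArm m ((frameIso i).symm '' A) k₀ K R₀ χ) (hχ : χ = {v | v ∈ frameConfig i ω ↔ c}) {b : Site 2}
    (hFb : F.b = (frameIso i).symm b) (hb : ((N + 1 : ℕ) : ℤ) ≤ triNorm b) (hmN : m ≤ N + 1) :
    ∃ t : Site 2, triNorm t = (N + 1 : ℕ) ∧ triNorm (frameIso i F.z) = m ∧
      PathIn triGraph ((triAnn m (N + 1) ∩ A) ∩ {v | v ∈ ω ↔ c}) (frameIso i F.z) t := by
  have hz : triNorm (frameIso i F.z) = m := by rw [triNorm_frameIso i hi]; exact triNorm_of_isIntJ F.z_isIntJ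
  have P0 : PathIn triGraph (((frameIso i).symm '' A) ∩ {v | v ∈ frameConfig i ω ↔ c}) F.b F.z := hχ ▸ F.path_tip
  have P := pathIn_of_frameConfig i P0
  rw [image_frameIso_symm_image, hFb] at P
  rw [show ((frameIso i : triGraph ≃g triGraph) ((frameIso i).symm b)) = b from (frameIso i).apply_symm_apply b] at P
  have P' : PathIn triGraph (triAnn m (N + N / 8) ∩ (A ∩ {v | v ∈ ω ↔ c})) (frameIso i F.z) b :=
    P.symm.mono fun v hv => ⟨mem_triAnn.2 (hAn v hv.1), hv⟩
  obtain ⟨t, ht, hq⟩ := PathIn.exists_first_reach (N := N + 1) P' (by rw [hz]; exact_mod_cast hmN) hb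
  exact ⟨t, ht, hz, hq.mono fun v hv => ⟨⟨hv.1, hv.2.1⟩, hv.2.2⟩⟩

/-- An attaching site (in the outer fence) has norm `≥ N + 1`, after framing. [folklore] -/
theorem norm_frameIso_attach {N s : ℕ} (hs : s < 6) {z u : Site 2} {χ : SiteConfig (Site 2)}
    (h : OpenVCrossThrough (sepOuterFence N z) (z 1 - (N / 64 : ℕ)) (z 1 + (N / 64 : ℕ)) χ u) :
    ((N + 1 : ℕ) : ℤ) ≤ triNorm (frameIso s u) := by
  obtain ⟨b', t', -, -, q, -⟩ := h
  have := lt_triNorm_of_mem_sepOuterFence q.right_mem.1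
  rw [triNorm_frameIso s hs]; push_cast; omega

/-- **Surgery at the inner boundary for four arms** (Nolin 2008, §4.4, internal extremities,
`j = 4`): on `InGoodF`, four alternating arms landed on `∂Λ_N` are fenced at their inner ends on
`∂Λ_m`, the tips in the cyclic order of the landing sides (`m ≥ 5`, `2m < N`, `R₀ ≥ 2`,
`4 · R₀ 32^i < m` for `i < Kg`): `extFourArmQ m N ∩ InGoodF ⊆ IntTinyExt4 m N k₀ K R₀`. [cite: Nolin2008, §4.4 (arXiv 0711.4948: proof of Thm. 10, p. 13)] -/
theorem extFourArmQ_inter_inGoodF_subset4 {m N T k₀ K R₀ Kg : ℕ} (hm : 5 ≤ m) (hN : 2 * m < N) (hR₀ : 2 ≤ R₀)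
    (hRg : ∀ i < Kg, 4 * trapScale R₀ i < m) :
    extFourArmQ m N ∩ {ω | InGoodF m T k₀ K R₀ Kg ω} ⊆ IntTinyExt4 m N k₀ K R₀ := by
  rintro ω ⟨⟨h0, h2, h3, h5⟩, hgood⟩
  obtain ⟨z₀, u₀, a₀, hz₀, ha₀, hOut₀, P₀⟩ := h0
  obtain ⟨z₁, u₁, a₁, hz₁, ha₁, hOut₁, P₁⟩ := h2
  obtain ⟨z₂, u₂, a₂, hz₂, ha₂, hOut₂, P₂⟩ := h3
  obtain ⟨z₃, u₃, a₃, hz₃, ha₃, hOut₃, P₃⟩ := h5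
  have hN' : 2 * m ≤ N := hN.le
  -- the four arm paths in the original frame, with colours
  have Q₀ : PathIn triGraph (armRegion m N z₀ ∩ {v | v ∈ ω ↔ true}) a₀ u₀ :=
    P₀.mono fun v hv => ⟨hv.1, by simpa using hv.2⟩
  have Q₁ : PathIn triGraph ((frameIso 2 '' armRegion m N z₁) ∩ {v | v ∈ ω ↔ false}) (frameIso 2 a₁) (frameIso 2 u₁) :=
    pathIn_of_frameConfig 2 (P₁.mono fun v hv => ⟨hv.1, by
      have : v ∈ frameConfig 2 ωᶜ := hv.2
      rw [mem_frameConfig] at this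
      simpa [mem_frameConfig] using this⟩)
  have Q₂ : PathIn triGraph ((frameIso 3 '' armRegion m N z₂) ∩ {v | v ∈ ω ↔ true}) (frameIso 3 a₂) (frameIso 3 u₂) :=
    pathIn_of_frameConfig 3 (P₂.mono fun v hv => ⟨hv.1, by
      have : v ∈ frameConfig 3 ω := hv.2
      simpa [mem_frameConfig] using this⟩)
  have Q₃ : PathIn triGraph ((frameIso 5 '' armRegion m N z₃) ∩ {v | v ∈ ω ↔ false}) (frameIso 5 a₃) (frameIso 5 u₃) :=
    pathIn_of_frameConfig 5 (P₃.mono fun v hv => ⟨hv.1, by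
      have : v ∈ frameConfig 5 ωᶜ := hv.2
      rw [mem_frameConfig] at this
      simpa [mem_frameConfig] using this⟩)
  -- norms
  have hA₀ : ∀ v ∈ armRegion m N z₀, (m : ℤ) ≤ triNorm v ∧ triNorm v ≤ ((N + N / 8 : ℕ) : ℤ) := fun v hv => by
    have := norm_mem_frame_armRegion (m := m) (show 0 < 6 by norm_num) hN' hz₀ (frameIso 0 v) ⟨v, hv, rfl⟩
    exact this
  have hA₁ := norm_mem_frame_armRegion (m := m) (show 2 < 6 by norm_num) hN' hz₁
  have hA₂ := norm_mem_frame_armRegion (m := m) (show 3 < 6 by norm_num) hN' hz₂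
  have hA₃ := norm_mem_frame_armRegion (m := m) (show 5 < 6 by norm_num) hN' hz₃
  have hu₀ : ((N + 1 : ℕ) : ℤ) ≤ triNorm u₀ := norm_frameIso_attach (show 0 < 6 by norm_num) hOut₀
  have hu₁ := norm_frameIso_attach (show 2 < 6 by norm_num) hOut₁
  have hu₂ := norm_frameIso_attach (show 3 < 6 by norm_num) hOut₂
  have hu₃ := norm_frameIso_attach (show 5 < 6 by norm_num) hOut₃
  have hfar : ∀ {u : Site 2}, ((N + 1 : ℕ) : ℤ) ≤ triNorm u → 2 * (m : ℤ) < triNorm u := by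
    intro u h; push_cast at h; omega
  -- fencing
  obtain ⟨i₀, hi₀, F₀, hF₀⟩ := exists_intFencedArm_open hm hR₀ hRg hgood (fun v hv => (hA₀ v hv).1)
    (fun v hv => triAnnSet_subset_extRegion hN' z₀ hv) ha₀ (hfar hu₀) Q₀
  obtain ⟨i₁, hi₁, F₁, hF₁⟩ := exists_intFencedArm_closed hm hR₀ hRg hgood (fun v hv => (hA₁ v hv).1)
    (triAnnSet_subset_frame_armRegion (by norm_num) hN' z₁) (by rw [triNorm_frameIso 2 (by norm_num)]; exact ha₁) (hfar hu₁) Q₁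
  obtain ⟨i₂, hi₂, F₂, hF₂⟩ := exists_intFencedArm_open hm hR₀ hRg hgood (fun v hv => (hA₂ v hv).1)
    (triAnnSet_subset_frame_armRegion (by norm_num) hN' z₂) (by rw [triNorm_frameIso 3 (by norm_num)]; exact ha₂) (hfar hu₂) Q₂
  obtain ⟨i₃, hi₃, F₃, hF₃⟩ := exists_intFencedArm_closed hm hR₀ hRg hgood (fun v hv => (hA₃ v hv).1)
    (triAnnSet_subset_frame_armRegion (by norm_num) hN' z₃) (by rw [triNorm_frameIso 5 (by norm_num)]; exact ha₃) (hfar hu₃) Q₃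
  -- the tip paths cut at `∂Λ_{N+1}`
  have hmN : m ≤ N + 1 := by omega
  have hχo : ∀ j : ℕ, frameConfig j ω = {v | v ∈ frameConfig j ω ↔ true} := fun j => Set.ext fun v => by simp
  have hχc : ∀ j : ℕ, (frameConfig j ω)ᶜ = {v | v ∈ frameConfig j ω ↔ false} := fun j => Set.ext fun v => by simp
  obtain ⟨t₀, ht₀, hζ₀, T₀⟩ := IntFencedArm.exists_tip_path_cut hi₀ hA₀ F₀ (hχo i₀) hF₀ hu₀ hmN
  obtain ⟨t₁, ht₁, hζ₁, T₁⟩ := IntFencedArm.exists_tip_path_cut hi₁ hA₁ F₁ (hχc i₁) hF₁ hu₁ hmN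
  obtain ⟨t₂, ht₂, hζ₂, T₂⟩ := IntFencedArm.exists_tip_path_cut hi₂ hA₂ F₂ (hχo i₂) hF₂ hu₂ hmN
  obtain ⟨t₃, ht₃, hζ₃, T₃⟩ := IntFencedArm.exists_tip_path_cut hi₃ hA₃ F₃ (hχc i₃) hF₃ hu₃ hmN
  -- the order certificate
  have hchain := fourArm_chain (ω := ω) (by omega) (by omega)
    (X₀ := triAnn m (N + 1) ∩ armRegion m N z₀) (X₁ := triAnn m (N + 1) ∩ frameIso 2 '' armRegion m N z₁)
    (X₂ := triAnn m (N + 1) ∩ frameIso 3 '' armRegion m N z₂) (X₃ := triAnn m (N + 1) ∩ frameIso 5 '' armRegion m N z₃)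
    (fun v hv => hv.1) (fun v hv => hv.1) (fun v hv => hv.1) (fun v hv => hv.1)
    (fun v hv hvn => by
      change (0 : ℤ) ≤ hexPos (N + 1) (frameIso 0 v) ∧ hexPos (N + 1) (frameIso 0 v) < ((N + 1 : ℕ) : ℤ)
      have := hexPos_block_of_mem_frame_region (m := m) hz₀ (i := 0) (Or.inl rfl) ⟨v, hv.2, rfl⟩ hvn
      push_cast at this ⊢; omega)
    (fun v hv hvn => by have := hexPos_block_of_mem_frame_region (m := m) hz₁ (Or.inr (Or.inl rfl)) hv.2 hvn; push_cast at this ⊢; omega)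
    (fun v hv hvn => by have := hexPos_block_of_mem_frame_region (m := m) hz₂ (Or.inr (Or.inr (Or.inl rfl))) hv.2 hvn; push_cast at this ⊢; omega)
    (fun v hv hvn => by have := hexPos_block_of_mem_frame_region (m := m) hz₃ (Or.inr (Or.inr (Or.inr rfl))) hv.2 hvn; push_cast at this ⊢; omega)
    hζ₀ hζ₁ hζ₂ hζ₃ ht₀ ht₁ ht₂ ht₃
    (T₀.mono fun v hv => ⟨hv.1, by simpa using hv.2⟩) (T₁.mono fun v hv => ⟨hv.1, by simpa using hv.2⟩)
    (T₂.mono fun v hv => ⟨hv.1, by simpa using hv.2⟩) (T₃.mono fun v hv => ⟨hv.1, by simpa using hv.2⟩)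
  refine ⟨![z₀, z₁, z₂, z₃], ![u₀, u₁, u₂, u₃], ?_, hOut₀, hOut₁, hOut₂, hOut₃, ![i₀, i₁, i₂, i₃], ?_, F₀, F₁, F₂, F₃,
    hF₀, hF₁, hF₂, hF₃, hchain.1, hchain.2⟩
  · intro a; fin_cases a <;> assumption
  · intro a; fin_cases a <;> assumption

/-! ### The framed good event fails with small probability, at density `p` -/

/-- **Nothing fails around `∂Λ_m` (framed) except with small probability, at density `p`**
(Nolin 2008, proof of Thm. 11 with Lemma 15, internal extremities, "for any `p`, any `P̂`
between `P_p` and `P_{1-p}`"): for `m ≥ 8`, `k₀, R₀ ≥ 1`, `2 k_j + 1 ≤ R₀`, `8 k_j < S`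
(`j < K`), `8 R₀ 32^i < S` (`i < Kg`), given at both densities `q ∈ {p, 1 - p}` open frames of
probability `≥ c_F ∈ (0, 1]` at the scales `< S` and the RSW bound `c ≤ P_q(LR(L, ⌊m/8⌋))`
(`L ≤ 24 ⌊m/8⌋`): `P_p(¬ InGoodF m T k₀ K R₀ Kg) ≤ 12 · ((1 - c⁵)^{T+1} + T (1 - c_F²)^K + 2 (1 - c_F²)^{Kg})`
— six framed configurations of law `P_p` (`real_preimage_frameConfig`) and six colour-exchanged
ones, of law `P_{1-p}`. [cite: Nolin2008, §4.4 Lemma 15 and Thm. 11 (proof) (arXiv 0711.4948: Lemma 14 (4.20), Thm. 10), with Thm. 11 "uniformly in p"] -/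
theorem real_not_inGoodF_le_at (p : unitInterval) {cF c : ℝ} (hcF : 0 < cF) (hcF1 : cF ≤ 1) {S : ℕ}
    (hF : ∀ q : unitInterval, (q = p ∨ q = unitInterval.symm p) →
      ∀ (z : Site 2) (k : ℕ), 1 ≤ k → k < S → cF ≤ (triSitePercolation q).real (triFrameAt z k))
    {m : ℕ} (hm : 8 ≤ m)
    (hcw : ∀ q : unitInterval, (q = p ∨ q = unitInterval.symm p) → ∀ L : ℕ, L ≤ 24 * (m / 8) → c ≤ triLRCrossingProb q L (m / 8))
    (hc : 0 ≤ c) {T k₀ K R₀ Kg : ℕ} (hk₀ : 1 ≤ k₀) (hR₀ : 1 ≤ R₀) (hKR : ∀ j < K, 2 * trapScale k₀ j + 1 ≤ R₀)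
    (hKS : ∀ j < K, 8 * trapScale k₀ j < S) (hKgS : ∀ i < Kg, 8 * trapScale R₀ i < S) :
    (triSitePercolation p).real {ω | ¬ InGoodF m T k₀ K R₀ Kg ω} ≤
      12 * ((1 - c ^ 5) ^ (T + 1) + T * (1 - cF ^ 2) ^ K + 2 * (1 - cF ^ 2) ^ Kg) := by
  set B := inBad m T k₀ K R₀ Kg with hB
  set ε := (1 - c ^ 5) ^ (T + 1) + T * (1 - cF ^ 2) ^ K + 2 * (1 - cF ^ 2) ^ Kg with hε
  have hF' : ∀ q : unitInterval, (q = unitInterval.symm p ∨ q = unitInterval.symm (unitInterval.symm p)) →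
      ∀ (z : Site 2) (k : ℕ), 1 ≤ k → k < S → cF ≤ (triSitePercolation q).real (triFrameAt z k) := by
    intro q hq
    rw [unitInterval.symm_symm] at hq
    exact hF q hq.symm
  have hbad : (triSitePercolation p).real B ≤ ε :=
    real_inBad_le_at p hcF hcF1 hF hm (hcw (unitInterval.symm p) (Or.inr rfl)) hc hk₀ hR₀ hKR hKS hKgS
  have hbad' : (triSitePercolation (unitInterval.symm p)).real B ≤ ε :=
    real_inBad_le_at (unitInterval.symm p) hcF hcF1 hF' hm (by rw [unitInterval.symm_symm]; exact hcw p (Or.inl rfl))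
      hc hk₀ hR₀ hKR hKS hKgS
  have hrot : ∀ i : ℕ, (triSitePercolation p).real (frameConfig i ⁻¹' B) ≤ ε := fun i => by
    rw [real_preimage_frameConfig]; exact hbad
  have hrotc : ∀ i : ℕ, (triSitePercolation p).real (frameConfig i ⁻¹' (compl ⁻¹' B)) ≤ ε := fun i => by
    rw [real_preimage_frameConfig]
    unfold triSitePercolation
    rw [sitePercolation_real_preimage_compl]
    exact hbad'
  calc (triSitePercolation p).real {ω | ¬ InGoodF m T k₀ K R₀ Kg ω}
      ≤ (triSitePercolation p).real
          (⋃ i ∈ Finset.range 6, (frameConfig i ⁻¹' B ∪ frameConfig i ⁻¹' (compl ⁻¹' B))) :=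
        measureReal_mono (not_inGoodF_subset m T k₀ K R₀ Kg) (measure_ne_top _ _)
    _ ≤ ∑ i ∈ Finset.range 6, (triSitePercolation p).real (frameConfig i ⁻¹' B ∪ frameConfig i ⁻¹' (compl ⁻¹' B)) :=
        measureReal_biUnion_finset_le _ _
    _ ≤ ∑ i ∈ Finset.range 6, (ε + ε) := Finset.sum_le_sum fun i _ =>
        (measureReal_union_le _ _).trans (add_le_add (hrot i) (hrotc i))
    _ = 12 * ε := by rw [Finset.sum_const, Finset.card_range, nsmul_eq_mul]; push_cast; ring

/-! ### The step inequality at density `p` -/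

/-- **The internal separation step for four arms, at density `p`** (Nolin 2008, §4.4, p. 13,
internal extremities, with Thm. 11 "uniformly in `p`"): for `m ≥ 5`, `2(2m+1) ≤ N`, `R₀ ≥ 2`,
`64 k_j < m`, `32 · R₀ 32^i ≤ m` and `4 · R₀ 32^i < m`,
`P_p(extFourArmQ m N) ≤ P_p(IntTinyExt4 m N k₀ K R₀) + P_p(¬ InGoodF m …) · P_p(extFourArmQ (2m+1) N)`:
off `InGoodF` the arms still cross from `∂Λ_{2m+1}` (`extFourArmQ_mono`), an event determined
by the sites of norm `≥ 2m+1`, independent of `InGoodF` (determined by `Λ_{2m}`). [cite: Nolin2008, §4.4 (arXiv 0711.4948: proof of Thm. 10, p. 12–13), with Thm. 11 "uniformly in p"] -/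
theorem real_extFourArmQ_le_step4_at (p : unitInterval) {m N T k₀ K R₀ Kg : ℕ} (hm : 5 ≤ m) (hN : 2 * (2 * m + 1) ≤ N)
    (hR₀ : 2 ≤ R₀) (hKm : ∀ j < K, 64 * trapScale k₀ j < m) (hRg : ∀ i < Kg, 32 * trapScale R₀ i ≤ m)
    (hRg' : ∀ i < Kg, 4 * trapScale R₀ i < m) :
    (triSitePercolation p).real (extFourArmQ m N) ≤
      (triSitePercolation p).real (IntTinyExt4 m N k₀ K R₀) +
        (triSitePercolation p).real {ω | ¬ InGoodF m T k₀ K R₀ Kg ω} * (triSitePercolation p).real (extFourArmQ (2 * m + 1) N) := by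
  classical
  have hsub : extFourArmQ m N ⊆ IntTinyExt4 m N k₀ K R₀ ∪ ({ω | ¬ InGoodF m T k₀ K R₀ Kg ω} ∩ extFourArmQ (2 * m + 1) N) := by
    intro ω hω
    by_cases hg : InGoodF m T k₀ K R₀ Kg ω
    · exact Or.inl (extFourArmQ_inter_inGoodF_subset4 hm (by omega) hR₀ hRg' ⟨hω, hg⟩)
    · exact Or.inr ⟨hg, extFourArmQ_mono (by omega) (by omega) hω⟩
  have dG : DeterminedBy {ω : SiteConfig (Site 2) | ¬ InGoodF m T k₀ K R₀ Kg ω} ↑(triBall (2 * m)) :=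
    (determinedBy_setOf_inGoodF hm hKm hRg).compl
  have dE : DeterminedBy (extFourArmQ (2 * m + 1) N) ↑(normShellFin (2 * m + 1) (N + N / 8)) :=
    determinedBy_extFourArmQ (n := 2 * m + 1) (N := N) (by omega)
  have hdisj : Disjoint (triBall (2 * m)) (normShellFin (2 * m + 1) (N + N / 8)) := by
    rw [Finset.disjoint_left]
    intro v hv hv'
    rw [mem_triBall_iff] at hv
    rw [mem_normShellFin] at hv'
    push_cast at hv hv'
    omega
  have hind := sitePercolation_real_inter_of_disjoint p dG dE hdisj
  unfold triSitePercolation at hind ⊢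
  calc (sitePercolation (Site 2) p).real (extFourArmQ m N)
      ≤ (sitePercolation (Site 2) p).real (IntTinyExt4 m N k₀ K R₀ ∪ ({ω | ¬ InGoodF m T k₀ K R₀ Kg ω} ∩ extFourArmQ (2 * m + 1) N)) :=
        measureReal_mono hsub (measure_ne_top _ _)
    _ ≤ (sitePercolation (Site 2) p).real (IntTinyExt4 m N k₀ K R₀) +
          (sitePercolation (Site 2) p).real ({ω | ¬ InGoodF m T k₀ K R₀ Kg ω} ∩ extFourArmQ (2 * m + 1) N) :=
        measureReal_union_le _ _
    _ = _ := by rw [hind]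

end Literature.Probability.Percolation
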